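import Literature.AnabelianGeometry.SemiGraphs.PSCVertexKernelStabilizerProofs
import Literature.AnabelianGeometry.SemiGraphs.PSCCoveringDatumTransport
import Literature.AnabelianGeometry.SemiGraphs.PSCUnrTransportProofs
import Literature.AnabelianGeometry.SemiGraphs.PSCVertexQuotientNontrivialProofs
import HarnessLib

/-!
# The covering datum `G_U`: dictionary for the vocabulary of [IUTchI] Rmk. 1.2.3 (iv)

PROOF-ONLY companion (abc-iut cell, row CombGC:Thm1.6(iii)/T16-L16, GAP-LEDGER G-w5d174-1) relating,
for a level `U` (open normal, `U ⊇ Ker(Π_G ↠ Π^unr_G)`) and the covering datum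
`D = G.restrict U hU` of abc-iut-L3-t4, the objects of [IUTchI] Remark 1.2.3 (iv) (kurims p. 42)
COMPUTED FOR THE DATUM `G_U` (abc-iut-w4-d052's `unrVertAb`, `IsElemAbUnrQuotient`,
`vertexQuotientKer` applied to `D`) with the level-`U` vocabulary of `G` used by the landed assembly
`PSCUnrVerticialNecessityProofs`:

* `unrVertAb_eq_vertFil_top_of_nonempty` — for any datum with a vertex, the inverse image of
  `M^unr-vert` is the inverse image of `M^vert` ([CombGC] Rmk. 1.1.4: "`M^vert/M^edge`, i.e. the
  direct sum of the abelianizations of the unramified verticial subgroups");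
* `map_subtype_unrVertAb_restrict` — hence `M^unr-vert_{G_U}` in `Π_G` is `vertFil U`;
* `isElemAbUnrQuotient_restrict_iff` — elementary abelian quotients of `M^unr_{G_U}` ↔ the binder
  shape `closure([U,U]·Ker) ⊆ H'`, `u^l ∈ H'`;
* `sup_smul_vertGp_eq_sup_vrep` — `U · Π_v^γ = U · Π_v^{y_w}` for the vertex `w = U γ Π_v`.

Pure group theory; 0 defs; nothing here takes a side on [IUTchIII] Cor. 3.12.
[cite: Mochizuki2012, IUTchI Rmk 1.2.3(iv) p.42] [cite: MochizukiCombGC2007, Rmk 1.1.4 p.8]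
-/

noncomputable section

namespace Literature.AnabelianGeometry.SemiGraphs

namespace PSCDatum

open scoped Pointwise
open PSCCovering

universe u

variable {P : Type u} [Group P] [TopologicalSpace P] [IsTopologicalGroup P]

/-! ### 1. `M^unr-vert = M^vert` (inverse images) for a datum with a vertex -/

omit [TopologicalSpace P] [IsTopologicalGroup P] in
/-- A conjugate of `A` lies in `A · N` whenever `N ⊇ [Π, Π]`. [folklore] -/
private theorem smul_le_sup_of_commutator_le {A N : Subgroup P} (hN : ⁅(⊤ : Subgroup P), ⊤⁆ ≤ N)
    (γ : ConjAct P) : γ • A ≤ A ⊔ N := by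
  intro x hx
  rw [Subgroup.mem_pointwise_smul_iff_inv_smul_mem, ConjAct.smul_def] at hx
  set g := ConjAct.ofConjAct γ⁻¹ with hg
  -- `x = [g⁻¹, g x g⁻¹]⁻¹ … ` : write `x = c * (g x g⁻¹)` with `c` a commutator
  have hc : x * (g * x * g⁻¹)⁻¹ ∈ N := by
    have : x * (g * x * g⁻¹)⁻¹ = x * g * x⁻¹ * g⁻¹ := by group
    rw [this]
    exact hN (Subgroup.commutator_mem_commutator (Subgroup.mem_top x) (Subgroup.mem_top g))
  have : x = x * (g * x * g⁻¹)⁻¹ * (g * x * g⁻¹) := by group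
  rw [this]
  exact Subgroup.mul_mem _ (Subgroup.mem_sup_right hc) (Subgroup.mem_sup_left hx)

/-- **`M^unr-vert_G = M^vert_G`** (inverse images in `Π_G`) for a datum with at least one vertex: the
closed subgroup generated by the `M^unr_G[w]` ([IUTchI] Rmk. 1.2.3 (iv)) is the one generated by
`[Π, Π]` and all verticial subgroups ([CombGC] Def. 1.1 (ii) `M^vert`, which contains `M^edge`, Rmk.
1.1.4). [cite: MochizukiCombGC2007, Rmk 1.1.4 p.8] -/
theorem unrVertAb_eq_vertFil_top_of_nonempty (G : PSCDatum P) (hne : Nonempty G.graph.V) :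
    G.unrVertAb = G.vertFil ⊤ := by
  obtain ⟨w₀⟩ := hne
  have hcommE : ⁅(⊤ : Subgroup P), ⊤⁆ ≤ G.unrAbKer := G.commutator_le_unrAbKer
  refine le_antisymm ?_ ?_
  · refine Subgroup.topologicalClosure_minimal _ (iSup_le fun w => ?_)
      (Subgroup.isClosed_topologicalClosure _)
    refine Subgroup.topologicalClosure_minimal _ (sup_le ?_ ?_) (Subgroup.isClosed_topologicalClosure _)
    · refine (Subgroup.le_topologicalClosure _).trans' (le_sup_right.trans' ?_)
      exact le_iSup_of_le ⟨G.vertGp w, 1 • G.vertGp w, ⟨w, 1, rfl⟩, by rw [one_smul, top_inf_eq]⟩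
        le_rfl
    · exact Subgroup.topologicalClosure_minimal _
        (sup_le (G.commutator_le_vertFil ⊤) (G.unrKer_le_vertFil le_top))
        (Subgroup.isClosed_topologicalClosure _)
  · refine Subgroup.topologicalClosure_minimal _ (sup_le ?_ (iSup_le fun A => ?_))
      (Subgroup.isClosed_topologicalClosure _)
    · exact (hcommE.trans (G.unrAbKer_le_unrVertAbOf w₀)).trans (G.unrVertAbOf_le_unrVertAb w₀)
    · obtain ⟨A, B, ⟨w, γ, rfl⟩, rfl⟩ := A
      change ⊤ ⊓ γ • G.vertGp w ≤ G.unrVertAb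
      rw [top_inf_eq]
      refine (smul_le_sup_of_commutator_le hcommE γ).trans ?_
      exact (sup_le (G.vertGp_le_unrVertAbOf w) (G.unrAbKer_le_unrVertAbOf w)).trans
        (G.unrVertAbOf_le_unrVertAb w)

/-! ### 2. The covering datum `G_U` -/

section Restrict

variable (G : PSCDatum P) (U : Subgroup P) [U.FiniteIndex] (hU : IsOpen (U : Set P))

/-- **`M^unr-vert_{G_U}` in `Π_G` is `vertFil U`** (for `U ⊇ Ker` and `G_U` with a vertex).
[cite: Mochizuki2012, IUTchI Rmk 1.2.3(iv) p.42] -/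
theorem map_subtype_unrVertAb_restrict (hne : Nonempty (G.restrictGraph U).V) :
    ((G.restrict U hU).unrVertAb).map U.subtype = G.vertFil U := by
  rw [(G.restrict U hU).unrVertAb_eq_vertFil_top_of_nonempty hne, G.map_subtype_vertFil hU,
    ← MonoidHom.range_eq_map, Subgroup.range_subtype]

/-- `M^unr-vert_{G_U} ∩ H'` in `Π_G` is `vertFil U ∩ H'` (`H' ⊆ U`).
[cite: Mochizuki2012, IUTchI Rmk 1.2.3(iv) p.42] -/
theorem map_subtype_unrVertAb_inf_restrict (hne : Nonempty (G.restrictGraph U).V) {H' : Subgroup P}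
    (hH'U : H' ≤ U) :
    ((G.restrict U hU).unrVertAb ⊓ H'.subgroupOf U).map U.subtype = G.vertFil U ⊓ H' := by
  rw [Subgroup.map_inf _ _ _ U.subtype_injective, G.map_subtype_unrVertAb_restrict U hU hne,
    Subgroup.subgroupOf_map_subtype, inf_eq_left.mpr hH'U]

/-- `M^unr-vert_{G_U} · H' = Π_{G_U}` iff `vertFil U · H' = U` (`H' ⊆ U`).
[cite: Mochizuki2012, IUTchI Rmk 1.2.3(iv) p.42] -/
theorem unrVertAb_sup_eq_top_restrict_iff (hne : Nonempty (G.restrictGraph U).V) {H' : Subgroup P}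
    (hH'U : H' ≤ U) :
    (G.restrict U hU).unrVertAb ⊔ H'.subgroupOf U = ⊤ ↔ G.vertFil U ⊔ H' = U := by
  rw [← (Subgroup.map_injective U.subtype_injective).eq_iff, Subgroup.map_sup,
    G.map_subtype_unrVertAb_restrict U hU hne, Subgroup.subgroupOf_map_subtype, inf_eq_left.mpr hH'U,
    ← MonoidHom.range_eq_map, Subgroup.range_subtype]

/-- **Elementary abelian quotients of `M^unr_{G_U}`** (abc-iut-w4-d052's `IsElemAbUnrQuotient` for the
datum `G_U`) ↔ the level-`U` binder shape of `PSCUnrVerticialNecessityProofs`: `H' ⊆ U` open, normal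
in `U`, `closure([U,U] · Ker) ⊆ H'`, `u^l ∈ H'` (`U ⊇ Ker`). [cite: Mochizuki2012, IUTchI Rmk 1.2.3(iv) p.42] -/
theorem isElemAbUnrQuotient_restrict_iff (hKU : G.unrKer ≤ U) {l : ℕ} {H' : Subgroup P}
    (hH'U : H' ≤ U) :
    (G.restrict U hU).IsElemAbUnrQuotient l (H'.subgroupOf U) ↔
      ((H'.subgroupOf U).Normal ∧ IsOpen (H' : Set P) ∧
        (⁅U, U⁆ ⊔ G.unrKer).topologicalClosure ≤ H' ∧ ∀ u ∈ U, u ^ l ∈ H') := by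
  unfold IsElemAbUnrQuotient
  rw [isOpen_subgroupOf_iff hU hH'U]
  refine and_congr_right fun _ => and_congr_right fun _ => and_congr ?_ ?_
  · rw [← G.map_subtype_unrAbKer_restrict U hU hKU, Subgroup.map_le_iff_le_comap]
    rfl
  · constructor
    · intro h u hu
      have := h ⟨u, hu⟩
      rw [Subgroup.mem_subgroupOf, Subgroup.coe_pow] at this
      exact this
    · intro h u
      rw [Subgroup.mem_subgroupOf, Subgroup.coe_pow]
      exact h u u.2

omit [TopologicalSpace P] [IsTopologicalGroup P] [U.FiniteIndex] in
/-- Conjugating by an element of the normal subgroup `U` does not change `U ⊔ X`. [folklore] -/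
private theorem sup_conj_smul_eq_of_mem (hUn : U.Normal) {u : P} (hu : u ∈ U) (X : Subgroup P) :
    U ⊔ ConjAct.toConjAct u • X = U ⊔ X := by
  have h1 : ConjAct.toConjAct u • (U ⊔ X) = U ⊔ X :=
    Subgroup.conjAct_pointwise_smul_eq_self (Subgroup.le_normalizer (Subgroup.mem_sup_left hu))
  rwa [Subgroup.smul_sup, hUn.conjAct (ConjAct.toConjAct u)] at h1

omit [IsTopologicalGroup P] in
/-- The vertex stabilizer `U · Π_v^γ` only depends on the vertex `U γ Π_v` of `G_U`: it equals
`U · Π_v^{y_w}` for the representative `y_w` (`U` normal). [cite: MochizukiCombGC2007, Def 1.1(ii) p.6] -/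
theorem sup_smul_vertGp_eq_sup_vrep (hUn : U.Normal) (v : G.graph.V) (γ : ConjAct P) :
    U ⊔ γ • G.vertGp v =
      U ⊔ ConjAct.toConjAct (G.vrep U ⟨v, dcIdx U (G.vertGp v) (ConjAct.ofConjAct γ)⟩) • G.vertGp v := by
  obtain ⟨u, hu, k, hk, hrep⟩ := exists_dcRep_dcIdx_eq U (G.vertGp v) (ConjAct.ofConjAct γ)
  change U ⊔ γ • G.vertGp v =
    U ⊔ ConjAct.toConjAct (dcRep U (G.vertGp v) (dcIdx U (G.vertGp v) (ConjAct.ofConjAct γ))) • G.vertGp v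
  rw [hrep, map_mul, map_mul, mul_smul, mul_smul, ConjAct.toConjAct_ofConjAct]
  have hk' : ConjAct.toConjAct k • G.vertGp v = G.vertGp v := by
    ext b
    rw [Subgroup.mem_pointwise_smul_iff_inv_smul_mem, ← ConjAct.toConjAct_inv, ConjAct.smul_def,
      ConjAct.ofConjAct_toConjAct, inv_inv]
    constructor
    · intro hb
      have hb' := (G.vertGp v).mul_mem ((G.vertGp v).mul_mem hk hb) ((G.vertGp v).inv_mem hk)
      rwa [show k * (k⁻¹ * b * k) * k⁻¹ = b by group] at hb'
    · exact fun hb => (G.vertGp v).mul_mem ((G.vertGp v).mul_mem ((G.vertGp v).inv_mem hk) hb) hk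
  rw [hk', sup_conj_smul_eq_of_mem U hUn hu]

end Restrict

end PSCDatum

end Literature.AnabelianGeometry.SemiGraphs

end
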